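import Literature.Geometry.Lorentzian.CausalityPushUp
import Summits.FinalStateConjecture.FinalStateConjecture.Theorems.EIHFluxBalanceInertialRecessionRechartCausalKit
import Summits.FinalStateConjecture.FinalStateConjecture.Statement
import Summits.FinalStateConjecture.FinalStateConjecture.Theorems.EIHFluxBalanceInertialRecessionGrowingRadius

/-!
# Route EIHFluxBalance — `InertialRecession`, re-charting: assembling the re-charted
# `FinalStateDecomposition` ON THE GIVEN REGION, for general spins and motions, with the re-typed
# summit clauses (honest-radii `HasExhaustiveCharts`, `IsFutureOriented`)

Helper file for the crux `stmt-FinalStateConjecture-10166`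
(`Summit.FinalStateConjecture.FinalStateConjecture.Theses.EIHFluxBalance.InertialRecession`),
stub `stub_rechart` of line `sublinear-is-free-clean-window-charges` (skeleton r11).

The summit re-typing of 2026-08-16 (semantic-vacuity audit, §2.1) strengthened
`Summit.FinalStateConjecture.HasExhaustiveCharts` (radii GROW, `Rᵢ(τ) → ∞`, and are HONEST,
`max (r₊(Mᵢ, aᵢ)) 0 + 1 ≤ Rᵢ(τ)`), and added `Summit.FinalStateConjecture.IsFutureOriented d` and
`Summit.FinalStateConjecture.RaysStayInClosure 𝒟 O` to the summit's conclusion.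
`exists_finalStateDecomposition_onRegion_of_rechart`: given, on a Cauchy development `𝒟`, the lab
chart `Φ : U → 𝒟` with its exterior region `O = J⁺(ι X) ∩ I⁻(Φ(E))`, hole charts `ψᵢ` on the
boosted Kerr exteriors `boostedKerrExterior Λᵢ cᵢ Mᵢ aᵢ` (arbitrary sub-extremal `(Mᵢ, aᵢ)` and
motions; smooth open embeddings into `Φ(E)`, near-zone `C²` convergence for every fixed radius and
along honest growing radii `Rcᵢ`, eventual pairwise disjointness, orthochronous `Λᵢ`, eventual
future-directedness of `dψᵢ(Λᵢ V_{Mᵢ,aᵢ})` on every truncated slab), a flat domain `U₀ ⊆ U` with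
its package (including eventual future-directedness of `dΦ e₀` on the flat slabs) and the TRANSFER
statement (every point of `O` is certified-late after chart time `τ₁` or in `J⁻` of the certified
slab, for every `τ₁ ≥ τ₀′`), it assembles `d : FinalStateDecomposition 𝒟 O 2` ON THE SAME REGION
`O`, with `O = exteriorOf 𝒟 d.charted`, sub-extremal holes, `HasExhaustiveCharts d` and
`IsFutureOriented d` — so a clause about `O` alone (`RaysStayInClosure 𝒟 O`) passes through
verbatim. Bookkeeping plus one causal lemma: the charted region `C′` is open, so `C′ ⊆ I⁻(C′)` and
`exteriorOf C′ ⊆ O`; conversely the transfer at chart time `τ₀′ + 1` puts every point of `O` in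
`C′ ∪ J⁻(C′)`, and `J⁻(C′) = I⁻(C′)` for the OPEN set `C′`
(`causalPast_subset_chronologicalPast_of_isOpen`: an open set lies in its own chronological past,
then push-up, O'Neill's Cor. 14.1), so `O = exteriorOf C′`.
`exists_finalStateDecomposition_onRegion_of_rechart'` is the same with OLD-STYLE radii (convergence
along `Rcᵢ` and the transfer for `Rcᵢ`, no growth, no honest floor): the honest growing radii are
`max (max (Rcᵢ τ) (Rgᵢ τ)) (r₊ᵢ + 1)`, `Rgᵢ → ∞` the diagonal radii of the fixed-radius convergence
(`exists_growing_radius'`); the certified sets and `J⁻` are monotone in the radii. The orientation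
inputs are discharged from (Ofut) and `C⁰` convergence in …StubRechart11Orient.
[O'Neill 1983, Ch. 14, pp. 402–404; folklore]
-/

noncomputable section

set_option linter.dupNamespace false

open scoped Topology ContDiff Manifold ENNReal
open Filter Set Topology Function TopologicalSpace Literature.Geometry.Lorentzian

namespace Summit.FinalStateConjecture.FinalStateConjecture.Theorems


/-! ### The causal past of an open set is its chronological past -/

section OpenPast

variable {E : Type*} [NormedAddCommGroup E] [NormedSpace ℝ E] [FiniteDimensional ℝ E] {H : Type*}
  [TopologicalSpace H] {I : ModelWithCorners ℝ E H} {n : WithTop ℕ∞} {M : Type*} [TopologicalSpace M]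
  [ChartedSpace H M] [IsManifold I ((⊤ : ℕ∞) : WithTop ℕ∞) M]
  {g : LorentzianMetric I n M} {τ : TimeOrientation g}

/-- **`J⁺(W) = I⁺(W)` for an open set `W`** (manifold without boundary, `Cⁿ` metric, `n ≥ 1`): a
point `q ∈ W` is in the chronological future of some `q' ∈ W` (an open set lies in its own
chronological future), and `q' ≪ q ≤ p` gives `q' ≪ p` (push-up, O'Neill's Cor. 14.1, read in the
reversed time orientation). O'Neill 1983, Ch. 14, pp. 402–403. [folklore] -/
theorem causalFuture_subset_chronologicalFuture_of_isOpen [BoundarylessManifold I M] (hn : 1 ≤ n)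
    {W : Set M} (hW : IsOpen W) : g.causalFuture τ W ⊆ g.chronologicalFuture τ W := by
  intro p hp
  rw [LorentzianMetric.causalFuture_eq_biUnion] at hp
  simp only [mem_iUnion, exists_prop] at hp
  obtain ⟨q, hqW, hpq⟩ := hp
  -- `q' ≪ q` for some `q' ∈ W`
  have hqI : q ∈ g.chronologicalFuture τ W := subset_chronologicalFuture_of_isOpen g τ hW hqW
  rw [LorentzianMetric.chronologicalFuture_eq_biUnion] at hqI
  simp only [mem_iUnion, exists_prop] at hqI
  obtain ⟨q', hq'W, hqq'⟩ := hqI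
  -- push-up in the reversed orientation: `q ∈ J⁻(p)`, `q' ∈ I⁻(q)` ⟹ `q' ∈ I⁻(p)`
  have h1 : q ∈ g.causalPast τ {p} := LorentzianMetric.mem_causalPast_singleton_iff.mpr hpq
  have h2 : q' ∈ g.chronologicalPast τ {q} :=
    LorentzianMetric.mem_chronologicalPast_of_mem_chronologicalFuture hqq'
  have h3 : q' ∈ g.chronologicalPast τ {p} :=
    LorentzianMetric.mem_chronologicalFuture_of_mem_causalFuture (τ := τ.reverse) hn h1 h2
  have h4 : p ∈ g.chronologicalFuture τ {q'} :=
    LorentzianMetric.mem_chronologicalFuture_of_mem_chronologicalPast h3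
  rw [LorentzianMetric.chronologicalFuture_eq_biUnion]
  simp only [mem_iUnion, exists_prop]
  exact ⟨q', hq'W, h4⟩

/-- **`J⁻(W) = I⁻(W)` for an open set `W`** (time dual of
`causalFuture_subset_chronologicalFuture_of_isOpen`). O'Neill 1983, Ch. 14, pp. 402–403. [folklore] -/
theorem causalPast_subset_chronologicalPast_of_isOpen [BoundarylessManifold I M] (hn : 1 ≤ n)
    {W : Set M} (hW : IsOpen W) : g.causalPast τ W ⊆ g.chronologicalPast τ W :=
  causalFuture_subset_chronologicalFuture_of_isOpen (τ := τ.reverse) hn hW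

/-- Registered one-line form (carrier `causalPast_subset_chronologicalPast_of_isOpen_rechart11` of
the crux item) of `causalPast_subset_chronologicalPast_of_isOpen`. [folklore] -/
theorem causalPast_subset_chronologicalPast_of_isOpen_rechart11 : open Literature.Geometry.Lorentzian in ∀ {E : Type*} [NormedAddCommGroup E] [NormedSpace ℝ E] [FiniteDimensional ℝ E] {H : Type*} [TopologicalSpace H] {I : ModelWithCorners ℝ E H} {n : WithTop ℕ∞} {M : Type*} [TopologicalSpace M] [ChartedSpace H M] [IsManifold I ((⊤ : ℕ∞) : WithTop ℕ∞) M] {g : LorentzianMetric I n M} {τ : TimeOrientation g} [BoundarylessManifold I M], 1 ≤ n → ∀ {W : Set M}, IsOpen W → g.causalPast τ W ⊆ g.chronologicalPast τ W :=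
  fun hn _ hW ↦ causalPast_subset_chronologicalPast_of_isOpen hn hW

end OpenPast

section Core

variable {X : Type} [TopologicalSpace X] [ChartedSpace E3 X] [IsManifold (𝓡 3) ∞ X]
  [ConnectedSpace X] {D : InitialDataSet (𝓡 3) X}

set_option maxHeartbeats 800000 in -- long bookkeeping proof
/-- **Assembly of the re-charted decomposition with the re-typed summit clauses (core).** See the
module docstring. [folklore] -/
theorem exists_finalStateDecomposition_onRegion_of_rechart (𝒟 : VacuumCauchyDevelopment D) {N : ℕ}
    (M a : Fin N → ℝ) (hsub : ∀ i, Kerr.IsSubextremal (M i) (a i))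
    (mot : Fin N → lorentzGroup × E4)
    (U : Opens E4) (Φ : U → 𝒟.carrier) (hΦ : ContMDiff 𝓘(ℝ, E4) (𝓡 4) ∞ Φ)
    (O : Set 𝒟.carrier) (Pext : U → Prop) {τ₀ τ₀' : ℝ} (hτ : τ₀ < τ₀')
    (hO : O = 𝒟.metric.causalFuture 𝒟.timeOrientation (range 𝒟.embed) ∩
      𝒟.metric.chronologicalPast 𝒟.timeOrientation (Φ '' {x : U | τ₀ < x.1 0 ∧ Pext x}))
    (himO : Φ '' {x : U | τ₀ < x.1 0 ∧ Pext x} ⊆ O)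
    -- the hole charts
    (ψ : ∀ i, (boostedKerrBackground (mot i).1 (mot i).2 (M i) (a i)).domain → 𝒟.carrier)
    (hψs : ∀ i, ContMDiff 𝓘(ℝ, E4) (𝓡 4) ∞ (ψ i))
    (hψemb : ∀ i, IsOpenEmbedding (ψ i))
    (hψE : ∀ i, range (ψ i) ⊆ Φ '' {x : U | τ₀ < x.1 0 ∧ Pext x})
    (hconvR : ∀ (i : Fin N) (Rr : ℝ), Tendsto (fun τ ↦ 𝒟.toSpacetime.truncDeviationCk
      (boostedKerrBackground (mot i).1 (mot i).2 (M i) (a i)) (ψ i) 2 Rr τ) atTop (𝓝 0))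
    (Rc : Fin N → ℝ → ℝ) (hRct : ∀ i, Tendsto (Rc i) atTop atTop)
    (hRc1 : ∀ i τ, max (Kerr.rPlus (M i) (a i)) 0 + 1 ≤ Rc i τ)
    (hRc : ∀ i, Tendsto (fun τ ↦ 𝒟.toSpacetime.truncDeviationCk
      (boostedKerrBackground (mot i).1 (mot i).2 (M i) (a i)) (ψ i) 2 (Rc i τ) τ) atTop (𝓝 0))
    (hdisj : ∀ Rr : ℝ, ∃ τ₁ : ℝ, Pairwise (Function.onFun Disjoint fun i ↦
      ψ i '' (boostedKerrBackground (mot i).1 (mot i).2 (M i) (a i)).truncLateRegion τ₁ Rr))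
    -- orientation of the hole charts (re-typed summit clause `IsFutureOriented`, (i)–(ii))
    (hmotO : ∀ i, Summit.FinalStateConjecture.IsOrthochronous (mot i).1)
    (hholeO : ∀ (i : Fin N) (ρ : ℝ), ∀ᶠ τ in atTop,
      ∀ y ∈ (boostedKerrBackground (mot i).1 (mot i).2 (M i) (a i)).truncTimeSlab ρ τ,
        𝒟.timeOrientation.IsFutureDirected (mfderiv 𝓘(ℝ, E4) (𝓡 4) (ψ i) y
          (((mot i).1 : E4 ≃L[ℝ] E4) (Kerr.timeVector (M i) (a i) (poincareInv (mot i).1 (mot i).2 (y : E4))))))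
    -- the flat chart
    (U₀ : Opens E4) (hU₀ : U₀ ≤ U) (ρexc : Fin N → ℝ → ℝ)
    (hexc : ∀ i, Tendsto (fun t ↦ ρexc i t / t) atTop (𝓝 0))
    (htube : {x : E4 | τ₀' < x 0 ∧ ∀ i, ρexc i (x 0) <
      Kerr.radius (a i) (poincareInv (mot i).1 (mot i).2 x)} ⊆ (U₀ : Set E4))
    (hflatdev : Tendsto (fun t ↦ 𝒟.toSpacetime.deviationCk (Minkowski.backgroundOn U₀)
      (Φ ∘ Opens.inclusion hU₀) 2 t) atTop (𝓝 0))
    (hflatemb : IsOpenEmbedding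
      (((Minkowski.backgroundOn U₀).lateRegion τ₀').restrict (Φ ∘ Opens.inclusion hU₀)))
    (hU₀E : ∀ x : U₀, τ₀' < x.1 0 → Pext (Opens.inclusion hU₀ x))
    -- orientation of the flat chart (re-typed summit clause `IsFutureOriented`, (iii))
    (hflatO : ∀ᶠ τ in atTop, ∀ x ∈ (Minkowski.backgroundOn U₀).timeSlab τ,
      𝒟.timeOrientation.IsFutureDirected
        (mfderiv 𝓘(ℝ, E4) (𝓡 4) (Φ ∘ Opens.inclusion hU₀) x (E4.basisVector 0)))
    -- the transfer (files `…RechartTransfer*`)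
    (htransfer : ∀ τ₁ : ℝ, τ₀' ≤ τ₁ →
      O ⊆ ((Φ ∘ Opens.inclusion hU₀) '' {x : U₀ | τ₁ < x.1 0} ∪
          ⋃ i, ψ i '' {y | τ₁ < (boostedKerrBackground (mot i).1 (mot i).2 (M i) (a i)).time y.1 ∧
            (boostedKerrBackground (mot i).1 (mot i).2 (M i) (a i)).radius y.1 ≤
              Rc i ((boostedKerrBackground (mot i).1 (mot i).2 (M i) (a i)).time y.1)}) ∪
        𝒟.metric.causalPast 𝒟.timeOrientation
          ((Φ ∘ Opens.inclusion hU₀) '' {x : U₀ | x.1 0 = τ₁} ∪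
            ⋃ i, ψ i '' (boostedKerrBackground (mot i).1 (mot i).2 (M i) (a i)).truncTimeSlab
              (Rc i τ₁) τ₁)) :
    ∃ d : FinalStateDecomposition 𝒟.toSpacetime O 2,
      (∀ i, Kerr.IsSubextremal (d.mass i) (d.spin i)) ∧
        O = Summit.FinalStateConjecture.exteriorOf 𝒟.toCauchyDevelopment d.charted ∧
          Summit.FinalStateConjecture.HasExhaustiveCharts d ∧ Summit.FinalStateConjecture.IsFutureOriented d := by
  -- notation
  set Kb : Fin N → ModelBackground := fun i ↦
    boostedKerrBackground (mot i).1 (mot i).2 (M i) (a i) with hKb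
  set E : Set U := {x : U | τ₀ < x.1 0 ∧ Pext x} with hE
  set C' : Set 𝒟.carrier := (Φ ∘ Opens.inclusion hU₀) '' (Minkowski.backgroundOn U₀).lateRegion τ₀' ∪
    ⋃ i, ψ i '' (Kb i).lateRegion τ₀' with hC'
  set O' : Set 𝒟.carrier := Summit.FinalStateConjecture.exteriorOf 𝒟.toCauchyDevelopment C'
    with hO'
  have hM : ∀ i, 0 < M i := fun i ↦ (abs_nonneg (a i)).trans_lt (hsub i)
  -- `C' ⊆ Φ(E)`, hence `O' ⊆ O`
  have hC'E : C' ⊆ Φ '' E := by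
    rintro p (⟨x, hx, rfl⟩ | hp)
    · exact ⟨Opens.inclusion hU₀ x, ⟨hτ.trans hx, hU₀E x hx⟩, rfl⟩
    · obtain ⟨i, y, -, rfl⟩ := mem_iUnion.mp hp
      exact hψE i (mem_range_self y)
  have hO'O : O' ⊆ O := by
    rw [hO]
    exact inter_subset_inter_right _ (LorentzianMetric.chronologicalFuture_mono hC'E)
  have hOJ : O ⊆ 𝒟.metric.causalFuture 𝒟.timeOrientation (range 𝒟.embed) := by
    rw [hO]; exact inter_subset_left
  -- `C'` is open
  have hlateo : ∀ (i) (τ : ℝ), IsOpen ((Kb i).lateRegion τ) := fun i τ ↦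
    isOpen_lt continuous_const (((PiLp.continuous_apply 2 _ 0).comp
      (continuous_poincareInv (mot i).1 (mot i).2)).comp continuous_subtype_val)
  have hC'o : IsOpen C' := by
    refine IsOpen.union ?_ (isOpen_iUnion fun i ↦ (hψemb i).isOpenMap _ (hlateo i τ₀'))
    rw [← range_restrict]
    exact hflatemb.isOpen_range
  -- every part of `C'` lies in `O'`
  have hpartO' : ∀ S : Set 𝒟.carrier, S ⊆ C' → S ⊆ O' := fun S hS ↦
    subset_inter (hS.trans (hC'E.trans (himO.trans hOJ)))
      (subset_chronologicalPast_of_subset_isOpen hC'o hS)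
  have hholeO' : ∀ i, ψ i '' (Kb i).lateRegion τ₀' ⊆ O' := fun i ↦
    hpartO' _ ((subset_iUnion (fun i ↦ ψ i '' (Kb i).lateRegion τ₀') i).trans subset_union_right)
  have hflatO' : (Φ ∘ Opens.inclusion hU₀) '' (Minkowski.backgroundOn U₀).lateRegion τ₀' ⊆ O' :=
    hpartO' _ subset_union_left
  -- `O ⊆ O'` (hence `O' = O`): by the transfer at chart time `τ₀' + 1`, every point of `O` is
  -- charted-late or in `J⁻` of a certified slab inside `C'`, and `J⁻(C') ⊆ I⁻(C')` (`C'` open)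
  have hOO' : O ⊆ O' := by
    intro p hp
    refine ⟨hOJ hp, ?_⟩
    have hC'I : C' ⊆ 𝒟.metric.chronologicalPast 𝒟.timeOrientation C' :=
      subset_chronologicalPast_of_subset_isOpen hC'o subset_rfl
    have hJI : 𝒟.metric.causalPast 𝒟.timeOrientation C' ⊆
        𝒟.metric.chronologicalPast 𝒟.timeOrientation C' :=
      causalPast_subset_chronologicalPast_of_isOpen
        (WithTop.coe_le_coe.mpr le_top : ((1 : ℕ∞) : ℕ∞ω) ≤ ((⊤ : ℕ∞) : ℕ∞ω)) hC'o
    rcases htransfer (τ₀' + 1) (by linarith) hp with (⟨x, hx, rfl⟩ | hl) | hJ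
    · exact hC'I (Or.inl ⟨x, lt_trans (lt_add_one τ₀') hx, rfl⟩)
    · obtain ⟨i, y, ⟨hy1, -⟩, rfl⟩ := mem_iUnion.mp hl
      exact hC'I (Or.inr (mem_iUnion.mpr ⟨i, y, lt_trans (lt_add_one τ₀') hy1, rfl⟩))
    · refine hJI (LorentzianMetric.causalFuture_mono ?_ hJ)
      rintro q (⟨x, hx, rfl⟩ | hq)
      · refine Or.inl ⟨x, ?_, rfl⟩
        show τ₀' < x.1 0
        rw [show x.1 0 = τ₀' + 1 from hx]; exact lt_add_one τ₀'
      · obtain ⟨i, y, hy, rfl⟩ := mem_iUnion.mp hq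
        refine Or.inr (mem_iUnion.mpr ⟨i, y, ?_, rfl⟩)
        show τ₀' < (Kb i).time y.1
        rw [hy.1]; exact lt_add_one τ₀'
  have hOeq : O' = O := Subset.antisymm hO'O hOO'
  -- the decomposition
  let d : FinalStateDecomposition 𝒟.toSpacetime O 2 :=
    { N := N
      mass := M
      spin := a
      mass_pos := hM
      abs_spin_le_mass := fun i ↦ (hsub i).le
      motion := mot
      τ₀ := τ₀'
      chart := fun i ↦ ψ i
      isLateChart := fun i ↦ ⟨hψs i,
        (hψemb i).comp (hlateo i τ₀').isOpenEmbedding_subtypeVal, (hholeO' i).trans hO'O⟩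
      tendsto_truncDeviationCk := fun i Rr ↦ hconvR i Rr
      exists_pairwise_disjoint := hdisj
      excision := ρexc
      tendsto_excision_div := hexc
      flatDomain := U₀
      setOf_lt_excision_subset_flatDomain := htube
      flatChart := Φ ∘ Opens.inclusion hU₀
      isLateChart_flat := ⟨hΦ.comp (contMDiff_inclusion hU₀), hflatemb, hflatO'.trans hO'O⟩
      tendsto_deviationCk_flat := hflatdev
      diff_subset_causalPast := by
        intro p hp
        rcases htransfer τ₀' le_rfl hp.1 with hl | hJ
        · -- certified-late points are charted-late
          exfalso
          refine hp.2 ?_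
          rcases hl with ⟨x, hx, rfl⟩ | hl
          · exact Or.inr ⟨x, hx, rfl⟩
          · obtain ⟨i, y, ⟨hy1, -⟩, rfl⟩ := mem_iUnion.mp hl
            exact Or.inl (mem_iUnion.mpr ⟨i, y, hy1, rfl⟩)
        · refine LorentzianMetric.causalFuture_mono ?_ hJ
          rintro q (⟨x, hx, rfl⟩ | hq)
          · exact Or.inr ⟨x, hx, rfl⟩
          · obtain ⟨i, y, hy, rfl⟩ := mem_iUnion.mp hq
            exact Or.inl (mem_iUnion.mpr ⟨i, y, hy.1, rfl⟩) }
  refine ⟨d, fun i ↦ hsub i, ?_, ⟨Rc, fun i ↦ ⟨hRct i, fun τ ↦ hRc1 i τ⟩, hRc, fun τ₁ hτ₁ ↦ ?_⟩,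
    ⟨hmotO, fun i ρ ↦ hholeO i ρ, hflatO⟩⟩
  · -- `O = J⁺(ι X) ∩ I⁻(d.charted)`: `d.charted = C'`
    exact hOeq.symm
  · -- exhaustion at chart time `τ₁ > τ₀'`
    intro p hp
    rcases htransfer τ₁ hτ₁.le hp.1 with hl | hJ
    · exact absurd hl hp.2
    · exact hJ

/-! ### Old-style radii: the honest growing radii are manufactured -/

/-- The truncated deviation at the larger of two radii is at most the sum of the two. [folklore] -/
private theorem truncDeviationCk_max_le_aux (𝓢 : Spacetime 4) (B : ModelBackground) (χ : B.domain → 𝓢.carrier)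
    (k : ℕ) (R₁ R₂ τ : ℝ) :
    𝓢.truncDeviationCk B χ k (max R₁ R₂) τ ≤ 𝓢.truncDeviationCk B χ k R₁ τ + 𝓢.truncDeviationCk B χ k R₂ τ := by
  rcases le_total R₁ R₂ with h | h
  · rw [max_eq_right h]; exact le_add_self
  · rw [max_eq_left h]; exact le_self_add

/-- Convergence along two radius profiles gives convergence along their `max`. [folklore] -/
private theorem tendsto_truncDeviationCk_max_aux (𝓢 : Spacetime 4) (B : ModelBackground) (χ : B.domain → 𝓢.carrier)
    (k : ℕ) {R₁ R₂ : ℝ → ℝ} (h₁ : Tendsto (fun τ ↦ 𝓢.truncDeviationCk B χ k (R₁ τ) τ) atTop (𝓝 0))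
    (h₂ : Tendsto (fun τ ↦ 𝓢.truncDeviationCk B χ k (R₂ τ) τ) atTop (𝓝 0)) :
    Tendsto (fun τ ↦ 𝓢.truncDeviationCk B χ k (max (R₁ τ) (R₂ τ)) τ) atTop (𝓝 0) :=
  tendsto_of_tendsto_of_tendsto_of_le_of_le tendsto_const_nhds (by simpa using h₁.add h₂)
    (fun _ ↦ zero_le) fun τ ↦ truncDeviationCk_max_le_aux 𝓢 B χ k (R₁ τ) (R₂ τ) τ

set_option maxHeartbeats 800000 in -- long bookkeeping proof
/-- **Assembly with the re-typed summit clauses, old-style radii.** As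
`exists_finalStateDecomposition_onRegion_of_rechart`, with near-zone convergence along radii `Rcᵢ` and
the transfer for `Rcᵢ` only (no growth, no honest lower bound); see the module docstring. [folklore] -/
theorem exists_finalStateDecomposition_onRegion_of_rechart' (𝒟 : VacuumCauchyDevelopment D) {N : ℕ}
    (M a : Fin N → ℝ) (hsub : ∀ i, Kerr.IsSubextremal (M i) (a i))
    (mot : Fin N → lorentzGroup × E4)
    (U : Opens E4) (Φ : U → 𝒟.carrier) (hΦ : ContMDiff 𝓘(ℝ, E4) (𝓡 4) ∞ Φ)
    (O : Set 𝒟.carrier) (Pext : U → Prop) {τ₀ τ₀' : ℝ} (hτ : τ₀ < τ₀')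
    (hO : O = 𝒟.metric.causalFuture 𝒟.timeOrientation (range 𝒟.embed) ∩
      𝒟.metric.chronologicalPast 𝒟.timeOrientation (Φ '' {x : U | τ₀ < x.1 0 ∧ Pext x}))
    (himO : Φ '' {x : U | τ₀ < x.1 0 ∧ Pext x} ⊆ O)
    -- the hole charts
    (ψ : ∀ i, (boostedKerrBackground (mot i).1 (mot i).2 (M i) (a i)).domain → 𝒟.carrier)
    (hψs : ∀ i, ContMDiff 𝓘(ℝ, E4) (𝓡 4) ∞ (ψ i))
    (hψemb : ∀ i, IsOpenEmbedding (ψ i))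
    (hψE : ∀ i, range (ψ i) ⊆ Φ '' {x : U | τ₀ < x.1 0 ∧ Pext x})
    (hconvR : ∀ (i : Fin N) (Rr : ℝ), Tendsto (fun τ ↦ 𝒟.toSpacetime.truncDeviationCk
      (boostedKerrBackground (mot i).1 (mot i).2 (M i) (a i)) (ψ i) 2 Rr τ) atTop (𝓝 0))
    (Rc : Fin N → ℝ → ℝ)
    (hRc : ∀ i, Tendsto (fun τ ↦ 𝒟.toSpacetime.truncDeviationCk
      (boostedKerrBackground (mot i).1 (mot i).2 (M i) (a i)) (ψ i) 2 (Rc i τ) τ) atTop (𝓝 0))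
    (hdisj : ∀ Rr : ℝ, ∃ τ₁ : ℝ, Pairwise (Function.onFun Disjoint fun i ↦
      ψ i '' (boostedKerrBackground (mot i).1 (mot i).2 (M i) (a i)).truncLateRegion τ₁ Rr))
    -- orientation of the hole charts (re-typed summit clause `IsFutureOriented`, (i)–(ii))
    (hmotO : ∀ i, Summit.FinalStateConjecture.IsOrthochronous (mot i).1)
    (hholeO : ∀ (i : Fin N) (ρ : ℝ), ∀ᶠ τ in atTop,
      ∀ y ∈ (boostedKerrBackground (mot i).1 (mot i).2 (M i) (a i)).truncTimeSlab ρ τ,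
        𝒟.timeOrientation.IsFutureDirected (mfderiv 𝓘(ℝ, E4) (𝓡 4) (ψ i) y
          (((mot i).1 : E4 ≃L[ℝ] E4) (Kerr.timeVector (M i) (a i) (poincareInv (mot i).1 (mot i).2 (y : E4))))))
    -- the flat chart
    (U₀ : Opens E4) (hU₀ : U₀ ≤ U) (ρexc : Fin N → ℝ → ℝ)
    (hexc : ∀ i, Tendsto (fun t ↦ ρexc i t / t) atTop (𝓝 0))
    (htube : {x : E4 | τ₀' < x 0 ∧ ∀ i, ρexc i (x 0) <
      Kerr.radius (a i) (poincareInv (mot i).1 (mot i).2 x)} ⊆ (U₀ : Set E4))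
    (hflatdev : Tendsto (fun t ↦ 𝒟.toSpacetime.deviationCk (Minkowski.backgroundOn U₀)
      (Φ ∘ Opens.inclusion hU₀) 2 t) atTop (𝓝 0))
    (hflatemb : IsOpenEmbedding
      (((Minkowski.backgroundOn U₀).lateRegion τ₀').restrict (Φ ∘ Opens.inclusion hU₀)))
    (hU₀E : ∀ x : U₀, τ₀' < x.1 0 → Pext (Opens.inclusion hU₀ x))
    -- orientation of the flat chart (re-typed summit clause `IsFutureOriented`, (iii))
    (hflatO : ∀ᶠ τ in atTop, ∀ x ∈ (Minkowski.backgroundOn U₀).timeSlab τ,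
      𝒟.timeOrientation.IsFutureDirected
        (mfderiv 𝓘(ℝ, E4) (𝓡 4) (Φ ∘ Opens.inclusion hU₀) x (E4.basisVector 0)))
    -- the transfer (files `…RechartTransfer*`)
    (htransfer : ∀ τ₁ : ℝ, τ₀' ≤ τ₁ →
      O ⊆ ((Φ ∘ Opens.inclusion hU₀) '' {x : U₀ | τ₁ < x.1 0} ∪
          ⋃ i, ψ i '' {y | τ₁ < (boostedKerrBackground (mot i).1 (mot i).2 (M i) (a i)).time y.1 ∧
            (boostedKerrBackground (mot i).1 (mot i).2 (M i) (a i)).radius y.1 ≤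
              Rc i ((boostedKerrBackground (mot i).1 (mot i).2 (M i) (a i)).time y.1)}) ∪
        𝒟.metric.causalPast 𝒟.timeOrientation
          ((Φ ∘ Opens.inclusion hU₀) '' {x : U₀ | x.1 0 = τ₁} ∪
            ⋃ i, ψ i '' (boostedKerrBackground (mot i).1 (mot i).2 (M i) (a i)).truncTimeSlab
              (Rc i τ₁) τ₁)) :
    ∃ d : FinalStateDecomposition 𝒟.toSpacetime O 2,
      (∀ i, Kerr.IsSubextremal (d.mass i) (d.spin i)) ∧
        O = Summit.FinalStateConjecture.exteriorOf 𝒟.toCauchyDevelopment d.charted ∧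
          Summit.FinalStateConjecture.HasExhaustiveCharts d ∧ Summit.FinalStateConjecture.IsFutureOriented d := by
  set Kb : Fin N → ModelBackground := fun i ↦
    boostedKerrBackground (mot i).1 (mot i).2 (M i) (a i) with hKb
  -- diagonal radii of the fixed-radius convergence
  have hg : ∀ i, ∃ Rg : ℝ → ℝ, Tendsto Rg atTop atTop ∧
      Tendsto (fun τ ↦ 𝒟.toSpacetime.truncDeviationCk (Kb i) (ψ i) 2 (Rg τ) τ) atTop (𝓝 0) := fun i ↦ by
    obtain ⟨Rg, -, hRt, hRc'⟩ := exists_growing_radius'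
      (f := fun τ r ↦ 𝒟.toSpacetime.truncDeviationCk (Kb i) (ψ i) 2 r τ) fun n ↦ hconvR i n
    exact ⟨Rg, hRt, hRc'⟩
  choose Rg hRgt hRgc using hg
  -- the honest growing radii
  set R : Fin N → ℝ → ℝ := fun i τ ↦ max (max (Rc i τ) (Rg i τ)) (Kerr.rPlus (M i) (a i) + 1) with hR
  have hRcR : ∀ i τ, Rc i τ ≤ R i τ := fun i τ ↦ (le_max_left _ _).trans (le_max_left _ _)
  have hrp : ∀ i, 0 < Kerr.rPlus (M i) (a i) := fun i ↦ by
    have h1 : 0 < M i := (abs_nonneg (a i)).trans_lt (hsub i)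
    unfold Kerr.rPlus
    linarith [Real.sqrt_nonneg (M i ^ 2 - a i ^ 2)]
  have hR1 : ∀ i τ, max (Kerr.rPlus (M i) (a i)) 0 + 1 ≤ R i τ := fun i τ ↦ by
    rw [max_eq_left (hrp i).le]
    exact le_max_right _ _
  have hRt : ∀ i, Tendsto (R i) atTop atTop := fun i ↦
    tendsto_atTop_mono (fun τ ↦ (le_max_right _ _).trans (le_max_left _ _)) (hRgt i)
  have hRconv : ∀ i, Tendsto (fun τ ↦ 𝒟.toSpacetime.truncDeviationCk (Kb i) (ψ i) 2 (R i τ) τ)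
      atTop (𝓝 0) := fun i ↦
    tendsto_truncDeviationCk_max_aux _ _ _ 2 (tendsto_truncDeviationCk_max_aux _ _ _ 2 (hRc i) (hRgc i))
      (hconvR i _)
  -- the transfer is monotone in the radii
  have htransfer' : ∀ τ₁ : ℝ, τ₀' ≤ τ₁ →
      O ⊆ ((Φ ∘ Opens.inclusion hU₀) '' {x : U₀ | τ₁ < x.1 0} ∪
          ⋃ i, ψ i '' {y | τ₁ < (Kb i).time y.1 ∧ (Kb i).radius y.1 ≤ R i ((Kb i).time y.1)}) ∪
        𝒟.metric.causalPast 𝒟.timeOrientation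
          ((Φ ∘ Opens.inclusion hU₀) '' {x : U₀ | x.1 0 = τ₁} ∪
            ⋃ i, ψ i '' (Kb i).truncTimeSlab (R i τ₁) τ₁) := by
    intro τ₁ hτ₁ p hp
    rcases htransfer τ₁ hτ₁ hp with (hl | hl) | hJ
    · exact Or.inl (Or.inl hl)
    · obtain ⟨i, y, ⟨hy1, hy2⟩, rfl⟩ := mem_iUnion.mp hl
      exact Or.inl (Or.inr (mem_iUnion.mpr ⟨i, y, ⟨hy1, hy2.trans (hRcR i _)⟩, rfl⟩))
    · refine Or.inr (LorentzianMetric.causalFuture_mono ?_ hJ)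
      refine union_subset_union le_rfl (iUnion_mono fun i ↦ image_mono ?_)
      exact (Kb i).truncTimeSlab_mono (hRcR i τ₁) τ₁
  exact exists_finalStateDecomposition_onRegion_of_rechart 𝒟 M a hsub mot U Φ hΦ O Pext hτ hO himO ψ hψs
    hψemb hψE hconvR R hRt hR1 hRconv hdisj hmotO hholeO U₀ hU₀ ρexc hexc htube hflatdev hflatemb hU₀E hflatO
    htransfer'

end Core

end Summit.FinalStateConjecture.FinalStateConjecture.Theorems

end
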